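import Literature.Probability.RandomPlanarGeometry.RestrictionMeasures
import Literature.Probability.RandomPlanarGeometry.RestrictionHullsProofs
import Literature.Probability.RandomPlanarGeometry.RestrictionHullsRiemannProofs
import Literature.Probability.RandomPlanarGeometry.RestrictionConfigEvents
import HarnessLib

/-!
# The avoidance events form a π-system ([LSW] §3 p. 10): discharge, and unconditional uniqueness of `P_α`

Proof-only companion of `Literature.Probability.RandomPlanarGeometry.RestrictionMeasures`, after

* G. F. Lawler, O. Schramm, W. Werner, *Conformal restriction: the chordal case*, J. Amer. Math.
  Soc. **16** (2003) 917–955, arXiv:math/0209343 (**[LSW]**), §3 p. 10: "It is easy to check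
  that this family of events is closed under finite intersection, so that a probability
  measure on `Ω` is characterized by the values of `P[K ∩ A = ∅]` for `A ∈ 𝒬*`."

* `Literature.Probability.RandomPlanarGeometry.RestrictionConfig.isPiSystem_avoid_holds` — DISCHARGE of the named fact
  `RestrictionConfig.isPiSystem_avoid`: for `A, A' ∈ 𝒬*`,
  `{K ∩ A = ∅} ∩ {K ∩ A' = ∅} = {K ∩ Fill(A ∪ A') = ∅}` with `Fill(A ∪ A')` the half-plane fill
  `hpFill (A ∪ A')` ([LSW] §2 "Fillings", file `HalfPlaneFill`), which is a `*`-hull as soon as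
  the intersection is nonempty: `A ∪ A'` is closed, bounded and attached to the lower half-plane
  (`IsBoundedHull.isConnected_union_im_nonpos`), so its fill is a bounded hull
  (`isBoundedHull_hpFill` with Conway VIII.2.2, `isSimplyConnected_of_isConnected_compl_holds`);
  a configuration `K` avoiding `A ∪ A'` is connected and unbounded in `ℍ ∖ (A ∪ A')`, hence lies
  in the unbounded component, i.e. avoids the fill (`RestrictionConfig.avoid_hpFill`), and drags
  a half-disc at `0 ∈ cl K` with it, so `0 ∉ hpFill (A ∪ A')`
  (`RestrictionConfig.zero_notMem_hpFill`). (If no configuration avoids `A ∪ A'` there is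
  nothing to show: Mathlib's `IsPiSystem` only asks for nonempty intersections.)
* `Literature.Probability.RandomPlanarGeometry.RestrictionConfig.ext_of_avoid_holds` — hence [LSW] Lemma 3.2 (`RestrictionConfig.ext_of_avoid`)
  unconditionally (`ext_of_avoid_of_isPiSystem`, Dynkin);
* `Literature.Probability.RandomPlanarGeometry.IsRestrictionMeasure.unique'` — hence the uniqueness of `P_α` ([LSW] Prop. 3.3, last
  sentence) unconditionally: the tree's `IsRestrictionMeasure.unique` fed with
  `ext_of_avoid_holds` and the proved §2 facts `IsStarHull.existsUnique_isRestrictionMap_holds`,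
  `IsStarHull.exists_hasRestrictionDeriv_holds`;
* `Literature.Probability.RandomPlanarGeometry.IsRestrictionMeasure.ae_of_exists`, `measure_eq_of_exists` — transfer by uniqueness: an
  almost-sure property (or the probability of an event) established for ONE restriction measure
  of exponent `α` — e.g. for the law of an explicit construction such as [LSW] Thm. 7.3's
  `Ξ(κ)` — holds for every `P` with `IsRestrictionMeasure α P`.

Mathlib: `IsPiSystem`, `MeasureTheory.ext_of_generate_finite` (through the tree's
`ext_of_avoid_of_isPiSystem`).
-/

noncomputable section

open Set Filter Topology MeasureTheory Metric Bornology
open UpperHalfPlane (upperHalfPlaneSet)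
open scoped NNReal ENNReal

namespace Literature.Probability.RandomPlanarGeometry

namespace RestrictionConfig

/-! ### Configurations avoiding a test set avoid its fill -/

variable {S : Set ℂ}

/-- A configuration avoiding `S` lies in the unbounded component of `ℍ ∖ S` (it is connected
and unbounded). [folklore] -/
theorem subset_unboundedComponent_of_disjoint (K : RestrictionConfig)
    (h : Disjoint (K : Set ℂ) S) :
    (K : Set ℂ) ⊆ Loewner.unboundedComponent (upperHalfPlaneSet \ S) :=
  subset_unboundedComponent_of_isPreconnected K.isConnected.isPreconnected
    (K.subset_diff_of_disjoint h) K.not_isBounded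

/-- **A configuration avoiding a bounded closed `S` avoids its fill** `hpFill S` ([LSW] remark
after Def. 3.1: whether `K ∩ A = ∅` only depends on the fill). [folklore] -/
theorem disjoint_hpFill_of_disjoint (K : RestrictionConfig) (hS : IsClosed S) (hSb : IsBounded S)
    (h : Disjoint (K : Set ℂ) S) : Disjoint (K : Set ℂ) (hpFill S) := by
  refine Set.disjoint_left.2 fun w hwK hwF ↦ ?_
  have : w ∈ hpFill S ∩ upperHalfPlaneSet := ⟨hwF, K.subset_upperHalfPlaneSet hwK⟩
  rw [hpFill_inter hS hSb] at this
  exact this.2 (K.subset_unboundedComponent_of_disjoint h hwK)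

/-- **The avoidance event of the fill**: for `S` closed and bounded,
`{K ∩ hpFill S = ∅} = {K ∩ S = ∅}` (`S ∩ ℍ ⊆ hpFill S` and configurations live in `ℍ`). [folklore] -/
theorem avoid_hpFill (hS : IsClosed S) (hSb : IsBounded S) : avoid (hpFill S) = avoid S := by
  ext K
  rw [mem_avoid, mem_avoid]
  refine ⟨fun h ↦ Set.disjoint_left.2 fun w hwK hwS ↦ ?_, K.disjoint_hpFill_of_disjoint hS hSb⟩
  exact Set.disjoint_left.1 h hwK (inter_subset_hpFill S ⟨hwS, K.subset_upperHalfPlaneSet hwK⟩)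

/-- **If some configuration avoids a closed `S ∌ 0`, then `0 ∉ hpFill S`**: a half-disc at `0`
missing `S` together with `K` (which meets it, `0 ∈ cl K`) is connected and unbounded in
`ℍ ∖ S`, so the unbounded component reaches `0`. [folklore] -/
theorem zero_notMem_hpFill (K : RestrictionConfig) (hS : IsClosed S) (h0S : (0 : ℂ) ∉ S)
    (h : Disjoint (K : Set ℂ) S) : (0 : ℂ) ∉ hpFill S := by
  set V : Set ℂ := Loewner.unboundedComponent (upperHalfPlaneSet \ S) with hV
  obtain ⟨ρ, hρ, hρS⟩ : ∃ ρ > 0, ball (0 : ℂ) ρ ⊆ Sᶜ :=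
    Metric.isOpen_iff.1 hS.isOpen_compl 0 h0S
  set W : Set ℂ := ball (0 : ℂ) ρ ∩ upperHalfPlaneSet with hW
  obtain ⟨k, hkK, hkρ⟩ : ((K : Set ℂ) ∩ ball 0 ρ).Nonempty := by
    have := K.zero_mem_closure
    rw [_root_.mem_closure_iff] at this
    obtain ⟨k, hk1, hk2⟩ := this (ball 0 ρ) isOpen_ball (mem_ball_self hρ)
    exact ⟨k, hk2, hk1⟩
  have hTV : W ∪ (K : Set ℂ) ⊆ V := by
    refine subset_unboundedComponent_of_isPreconnected ?_ ?_ ?_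
    · refine IsPreconnected.union k ⟨hkρ, K.subset_upperHalfPlaneSet hkK⟩ hkK ?_
        K.isConnected.isPreconnected
      exact ((convex_ball (0 : ℂ) ρ).inter (convex_halfSpace_im_gt 0)).isPreconnected
    · rintro w (⟨hwρ, hwH⟩ | hwK)
      · exact ⟨hwH, fun hwS ↦ hρS hwρ hwS⟩
      · exact ⟨K.subset_upperHalfPlaneSet hwK, Set.disjoint_left.1 h hwK⟩
    · exact fun hb ↦ K.not_isBounded (hb.subset subset_union_right)
  intro h0
  change (0 : ℂ) ∈ closure (upperHalfPlaneSet \ V) at h0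
  rw [_root_.mem_closure_iff] at h0
  obtain ⟨u, huρ, huH, huV⟩ := h0 (ball 0 ρ) isOpen_ball (mem_ball_self hρ)
  exact huV (hTV (Or.inl ⟨huρ, huH⟩))

/-- **The fill of the union of two `*`-hulls avoided by some configuration is a `*`-hull.**
`A ∪ A'` is closed, bounded, attached to the lower half-plane (each bounded hull is,
`IsBoundedHull.isConnected_union_im_nonpos`), so `hpFill (A ∪ A') ∈ 𝒬` (`isBoundedHull_hpFill`,
Conway VIII.2.2 proved), and `0 ∉ hpFill (A ∪ A')` by `zero_notMem_hpFill`.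
[cite: LawlerSchrammWerner2003Restriction, §3 p. 10 (before Lemma 3.2) with §2 p. 8 (Fillings)] -/
theorem isStarHull_hpFill_union {A A' : Set ℂ} (hA : IsStarHull A) (hA' : IsStarHull A')
    (K : RestrictionConfig) (hK : Disjoint (K : Set ℂ) (A ∪ A')) : IsStarHull (hpFill (A ∪ A')) := by
  have hc : IsClosed (A ∪ A') := hA.isBoundedHull.isClosed.union hA'.isBoundedHull.isClosed
  have hb : IsBounded (A ∪ A') := hA.isBoundedHull.1.union hA'.isBoundedHull.1
  have hconn : IsConnected ((A ∪ A') ∪ {z : ℂ | z.im ≤ 0}) := by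
    have h1 := hA.isBoundedHull.isConnected_union_im_nonpos
    have h2 := hA'.isBoundedHull.isConnected_union_im_nonpos
    have : (A ∪ A') ∪ {z : ℂ | z.im ≤ 0} = (A ∪ {z : ℂ | z.im ≤ 0}) ∪ (A' ∪ {z : ℂ | z.im ≤ 0}) := by
      ext z
      simp only [mem_union, mem_setOf_eq]
      tauto
    rw [this]
    exact IsConnected.union ⟨0, Or.inr (by simp), Or.inr (by simp)⟩ h1 h2
  have h0 : (0 : ℂ) ∉ A ∪ A' := fun h ↦ h.elim hA.zero_notMem hA'.zero_notMem
  exact isStarHull_hpFill isSimplyConnected_of_isConnected_compl_holds hc hb hconn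
    (K.zero_notMem_hpFill hc h0 hK)

/-! ### Discharge of `isPiSystem_avoid` and its consequences -/

/-- DISCHARGE — **the generating events `{K ∩ A = ∅}`, `A ∈ 𝒬*`, form a π-system** ([LSW] §3
p. 10: "It is easy to check that this family of events is closed under finite intersection"):
`{K ∩ A = ∅} ∩ {K ∩ A' = ∅} = {K ∩ (A ∪ A') = ∅} = {K ∩ hpFill (A ∪ A') = ∅}`
(`avoid_union`, `avoid_hpFill`), and `hpFill (A ∪ A')` is a `*`-hull whenever the intersection
is nonempty (`isStarHull_hpFill_union`). [cite: LawlerSchrammWerner2003Restriction, §3 p. 10 (before Lemma 3.2)] -/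
theorem isPiSystem_avoid_holds : isPiSystem_avoid := by
  rintro _ ⟨A, hA, rfl⟩ _ ⟨A', hA', rfl⟩ ⟨K, hKA, hKA'⟩
  have hK : Disjoint (K : Set ℂ) (A ∪ A') := by
    rw [mem_avoid] at hKA hKA'
    exact disjoint_union_right.2 ⟨hKA, hKA'⟩
  refine ⟨hpFill (A ∪ A'), isStarHull_hpFill_union hA hA' K hK, ?_⟩
  rw [← avoid_union, avoid_hpFill (hA.isBoundedHull.isClosed.union hA'.isBoundedHull.isClosed)
    (hA.isBoundedHull.1.union hA'.isBoundedHull.1)]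

/-- DISCHARGE — **[LSW] Lemma 3.2** unconditionally: two probability measures on `Ω` agreeing on
all events `{K ∩ A = ∅}`, `A ∈ 𝒬*`, are equal. [cite: LawlerSchrammWerner2003Restriction, Lemma 3.2 (p. 10)] -/
theorem ext_of_avoid_holds : ext_of_avoid :=
  ext_of_avoid_of_isPiSystem isPiSystem_avoid_holds

end RestrictionConfig

/-- **Uniqueness of `P_α`, unconditionally** ([LSW] Prop. 3.3, last sentence: "for each fixed
`α > 0`, there exists at most one probability measure `P_α` satisfying these conditions"): the
tree's `IsRestrictionMeasure.unique` with Lemma 3.2 (`ext_of_avoid_holds`) and the proved §2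
facts on `Φ_A`, `Φ'_A(0)`. [cite: LawlerSchrammWerner2003Restriction, Prop. 3.3 (pp. 10–11)] -/
theorem IsRestrictionMeasure.unique' {α : ℝ} {P P' : Measure RestrictionConfig}
    (h : IsRestrictionMeasure α P) (h' : IsRestrictionMeasure α P') : P = P' :=
  h.unique RestrictionConfig.ext_of_avoid_holds IsStarHull.existsUnique_isRestrictionMap_holds
    IsStarHull.exists_hasRestrictionDeriv_holds h'

/-- **Transfer of almost-sure properties by uniqueness**: a property holding almost surely for
SOME restriction measure of exponent `α` (e.g. the law of an explicit construction) holds almost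
surely for every `P` with `IsRestrictionMeasure α P`. [cite: LawlerSchrammWerner2003Restriction, Prop. 3.3 (pp. 10–11), uniqueness] -/
theorem IsRestrictionMeasure.ae_of_exists {α : ℝ} {p : RestrictionConfig → Prop}
    (hex : ∃ P₀ : Measure RestrictionConfig, IsRestrictionMeasure α P₀ ∧ ∀ᵐ K ∂P₀, p K)
    {P : Measure RestrictionConfig} (hP : IsRestrictionMeasure α P) : ∀ᵐ K ∂P, p K := by
  obtain ⟨P₀, hP₀, hp⟩ := hex
  rwa [hP.unique' hP₀]

/-- **Transfer of probabilities by uniqueness**: the probability of an event under any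
restriction measure of exponent `α` is its probability under a given one. [cite: LawlerSchrammWerner2003Restriction, Prop. 3.3 (pp. 10–11), uniqueness] -/
theorem IsRestrictionMeasure.measure_eq_of_exists {α : ℝ} {P₀ : Measure RestrictionConfig}
    (hP₀ : IsRestrictionMeasure α P₀) {P : Measure RestrictionConfig} (hP : IsRestrictionMeasure α P)
    (E : Set RestrictionConfig) : P E = P₀ E := by
  rw [hP.unique' hP₀]

end Literature.Probability.RandomPlanarGeometry

end
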